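import Literature.NumberTheory.EllipticCurves.KellerYin2024.PotentiallyGoodOrdinaryHeegnerPointMainConjecture
import Literature.NumberTheory.EllipticCurves.HeegnerModuleScalingDivisibilityProofs
import HarnessLib

/-!
# The TWISTED Heegner module of a rescaled parametrisation: `ℋ̄^θ_k(m • F) = m • ℋ̄^θ_k(F)`,
# `ℋ^θ_∞(m • F) = ℋ^θ_∞(F)` and `I(ℋ^θ_∞)` unchanged for `p ∤ m`, the any-`m` sandwich, and the
# `(HPMC)`-equality currency of Keller–Yin 2024b under rescaling

The twisted analogue of `HeegnerModuleScalingProofs` / `HeegnerModuleScalingDivisibilityProofs` (there for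
the tree's `HeegnerFamily` / `heegnerModule`): here for `TwistedHeegnerFamily N' W W' K κ jbar`
(`TwistedHeegnerModule.lean`: a parametrisation datum `Dt` of the AUXILIARY curve `W'` at level `N'`, a
`K̄`-isomorphism `T : E′_{K̄} ≅ E_{K̄}`, norm points `z_j`) and `twistedHeegnerModule` /
`twistedHeegnerCharIdeal`, the objects of Keller–Yin 2024b Thm. 3.5.1 as typed
(`KellerYin2024.thm351_hpmc_equality_OPEN`, `…_minimal_OPEN`; currency `KellerYin2024.HPMCEquality`).
Asked for by referee C3 ROUND 500 (b) (cell `bsd-cited`, D-AUDIT-r19 ADDENDUM-8): "for thm351's TWISTED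
shape p496710 contains no `twistedHeegnerModule`/`twistedHeegnerCharIdeal` instance, so consistency
there is by the SAME routine argument, not yet by name … the owner lands the twisted analogue of p496710".

* `IsTwistedHeegnerNormPoint.zsmul`, `TwistedHeegnerFamily.zsmul` / `zsmulSelf` (the rescaled twisted
  family: datum `Dt'` with `Dt'.φ = m • F.Dt.φ`, same `β`, same transport `T`, norm points `m • z_j` —
  `θ_C` is additive), `TwistedHeegnerFamily.generators_zsmul`;
* `twistedHeegnerModuleLayer_zsmul` (any `m`): `ℋ̄^θ_k(m • F) = m • ℋ̄^θ_k(F)`;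
* `twistedHeegnerModule_zsmul_of_not_dvd`, `twistedHeegnerCharIdeal_zsmul_of_not_dvd`,
  `twistedHeegnerCharIdeal_zsmulSelf_of_not_dvd`: **`ℋ^θ_∞(m • F) = ℋ^θ_∞(F)` and
  `I(ℋ^θ_∞(m • F)) = I(ℋ^θ_∞(F))` for `p ∤ m`**;
* `twistedHeegnerModule_zsmul_le`, `C_smul_mem_twistedHeegnerModule_zsmul`,
  `twistedHeegnerCharIdeal_dvd_zsmul`, `twistedHeegnerModuleIndex_le_zsmul` (any `m ≠ 0`): the sandwich
  `(C m) • ℋ^θ_∞(F) ⊆ ℋ^θ_∞(m • F) ⊆ ℋ^θ_∞(F)` and `I(ℋ^θ_∞(F)) ∣ I(ℋ^θ_∞(m • F))` (for `𝔖` f.g. and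
  `𝔖/ℋ^θ_∞(F)` torsion);
* `KellerYin2024.hpmcEquality_zsmul_of_not_dvd`, `KellerYin2024.hpmcEquality_zsmulSelf_iff_of_not_dvd`:
  **inside the `p`-adic-unit Manin class the typed (HPMC) equality `HPMCEquality D F X` does not depend on
  the parametrisation** — the by-name consistency certificate for `thm351_hpmc_equality_minimal_OPEN`'s
  Manin pin `¬ (p : ℤ) ∣ F.Dt.c` (REGISTER R-15, sub-instance thm351).

HONEST FRAMING: bookkeeping only (additivity of `θ_C`, of Kummer families and of `padicPi`/`conjPi`;
units of `Λ`); 0 named facts; `#print axioms` standard. No statement of the owners' modules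
(`TwistedHeegnerModule`, `KellerYin2024.PotentiallyGoodOrdinaryHeegnerPointMainConjecture`) is touched.

## References
* [Howard2004HeegnerKolyvagin] B. Howard, Compositio Math. 140 (2004): §1 ("Fixing a modular
  parametrization of `E` by `X_0(N)` yields a family of points"), §3.3 (`H_k`, `𝐇 = lim← H_k`).
* [CastellaHsieh2018] F. Castella, M.-L. Hsieh, Math. Ann. 370 (2018), §4.4 (the classes `z_{f,χ,c}`).
* [PerrinRiou1987BSMF] B. Perrin-Riou, Bull. SMF 115 (1987), §1 p. 405 (`I(H_∞)`; `H_∞` «dépendant du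
  choix de la paramétrisation π»; Conj. B carries `c_π · u`).
* [BurungaleCastellaKim2021] A. Burungale, F. Castella, C.-H. Kim, ANT 15 (2021), Remark after Conj. 1
  (the factor `c_π · #𝒪_K^×/2`, dropped for a `p`-adic unit).
* [SilvermanAEC2009] J. Silverman, *AEC*, III.3.1(b) (a change of variables is an isomorphism of groups),
  VIII.§2 (bilinearity of the Kummer pairing).
-/

open scoped Classical

open WeierstrassCurve Literature.NumberTheory.EllipticCurves
  Literature.NumberTheory.EllipticCurves.ModularForms

universe u

namespace Literature.NumberTheory.EllipticCurves

/-! ## §1 Rescaling transported norm points and twisted Heegner families -/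

section TwistedFamilyScaling

variable {K : Type u} [Field K] [NumberField K] {N' : ℕ} [NeZero N'] {W W' : WeierstrassCurve ℚ}
  {p : ℕ} [Fact p.Prime] {κ : ZpExtension K p} {jbar : AlgebraicClosure K →+* ℂ}

/-- **Transported norm points rescale**: if `Dt'.φ = m • Dt.φ` then `m • z` is the transported norm point
of the rescaled Heegner point `m • x′` (same transversal; `θ_C` is additive and the Galois action commutes
with `m •`). [cite: Howard2004HeegnerKolyvagin, §3.3 (the norm points Norm_{K[p^{k+1}]/K_k} P[p^{k+1}])] [cite: SilvermanAEC2009, III.3.1(b) (θ_C is a group isomorphism)] -/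
theorem IsTwistedHeegnerNormPoint.zsmul {Dt Dt' : ModularParametrizationData W' N'} (m : ℤ)
    (hφ : ∀ τ, Dt'.φ τ = m • Dt.φ τ) {β : ℤ} {T : GeomTransport W' W K} {n c : ℕ}
    {z : geomPoints (W.baseChange K)}
    (h : IsTwistedHeegnerNormPoint N' W W' K κ Dt β T jbar n c z) :
    IsTwistedHeegnerNormPoint N' W W' K κ Dt' β T jbar n c (m • z) := by
  obtain ⟨x', R, hx', hfix', hfix, hRsub, htrans, rfl⟩ := h
  refine ⟨m • x', R, hx'.zsmul m hφ, fun σ hσ ↦ ?_, fun σ hσ ↦ ?_, hRsub, htrans, ?_⟩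
  · rw [smul_zsmul_geomPoints, hfix' σ hσ]
  · rw [map_zsmul, smul_zsmul_geomPoints, hfix σ hσ]
  · rw [map_zsmul, Finset.smul_sum]
    exact Finset.sum_congr rfl fun r _ ↦
      (smul_zsmul_geomPoints (W := W.baseChange K) (n := m) r (T.equiv x')).symm

namespace TwistedHeegnerFamily

/-- **The rescaled twisted family `m • F`** along a datum `Dt'` of `E′` with `Dt'.φ = m • F.Dt.φ`: same
orientation, same transport `T`, norm points `m • z_j`. [cite: Howard2004HeegnerKolyvagin, §3.3 (the family of norm points)] [cite: CastellaHsieh2018, §4.4] -/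
noncomputable def zsmul (F : TwistedHeegnerFamily N' W W' K κ jbar) (Dt' : ModularParametrizationData W' N') (m : ℤ)
    (hφ : ∀ τ, Dt'.φ τ = m • F.Dt.φ τ) : TwistedHeegnerFamily N' W W' K κ jbar where
  Dt := Dt'
  β := F.β
  dvd_sq_sub := F.dvd_sq_sub
  T := F.T
  z := fun j ↦ m • F.z j
  isTwistedHeegnerNormPoint_z := fun j ↦ (F.isTwistedHeegnerNormPoint_z j).zsmul m hφ

/-- The norm points of the rescaled twisted family (unfolding). [cite: Howard2004HeegnerKolyvagin, §3.3] -/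
@[simp]
theorem zsmul_z (F : TwistedHeegnerFamily N' W W' K κ jbar) (Dt' : ModularParametrizationData W' N')
    (m : ℤ) (hφ : ∀ τ, Dt'.φ τ = m • F.Dt.φ τ) (j : ℕ) : (F.zsmul Dt' m hφ).z j = m • F.z j :=
  rfl

/-- The datum of the rescaled twisted family (unfolding). [cite: Howard2004HeegnerKolyvagin, §3.3] -/
@[simp]
theorem zsmul_Dt (F : TwistedHeegnerFamily N' W W' K κ jbar) (Dt' : ModularParametrizationData W' N')
    (m : ℤ) (hφ : ∀ τ, Dt'.φ τ = m • F.Dt.φ τ) : (F.zsmul Dt' m hφ).Dt = Dt' :=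
  rfl

/-- **The generators visible at layer `k` rescale**: `z_j ↦ m • z_j`. [cite: Howard2004HeegnerKolyvagin, §3.3 (generators of H_k)] -/
theorem generators_zsmul (F : TwistedHeegnerFamily N' W W' K κ jbar)
    (Dt' : ModularParametrizationData W' N') (m : ℤ) (hφ : ∀ τ, Dt'.φ τ = m • F.Dt.φ τ) (k : ℕ) :
    (F.zsmul Dt' m hφ).generators k = (fun w ↦ m • w) '' F.generators k := by
  unfold generators
  rw [Set.image_image]
  rfl

/-- **The constructed rescaling `F.zsmulSelf m`**: the datum is the tree's `F.Dt.zsmul m` (`[m] ∘ φ′`,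
Manin-constant field `m · c`, `ModularParametrizationScalingProofs`). [cite: Howard2004HeegnerKolyvagin, §1 ("Fixing a modular parametrization")] -/
noncomputable def zsmulSelf (F : TwistedHeegnerFamily N' W W' K κ jbar) (m : ℤ) (hm : m ≠ 0) :
    TwistedHeegnerFamily N' W W' K κ jbar :=
  F.zsmul (F.Dt.zsmul m hm) m (F.Dt.φ_zsmul hm)

end TwistedHeegnerFamily

end TwistedFamilyScaling

/-! ## §2 The twisted Heegner module of the rescaled family -/

section TwistedModuleScaling

variable {K : Type u} [Field K] [NumberField K] {N' : ℕ} [NeZero N'] {W W' : WeierstrassCurve ℚ}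
  {p : ℕ} [Fact p.Prime] {κ : ZpExtension K p} {γ : Field.absoluteGaloisGroup K}
  {jbar : AlgebraicClosure K →+* ℂ}

/-- **`ℋ̄^θ_k(m • F) = m • ℋ̄^θ_k(F)`** (any `m ∈ ℤ`) — word for word `heegnerModuleLayer_zsmul` for the
twisted family: Kummer families are additive (`IsKummerFamilyOver.zsmul`) and unique
(`IsKummerFamilyOver.unique`), `padicPi c` and `conjPi σ` are additive. [cite: Howard2004HeegnerKolyvagin, §3.3 (H_k is generated by the Kummer images of the norm points)] [cite: SilvermanAEC2009, VIII.§2 (the Kummer pairing is bilinear)] -/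
theorem twistedHeegnerModuleLayer_zsmul [W.IsElliptic] (F : TwistedHeegnerFamily N' W W' K κ jbar)
    (Dt' : ModularParametrizationData W' N') (m : ℤ) (hφ : ∀ τ, Dt'.φ τ = m • F.Dt.φ τ) (k : ℕ) :
    twistedHeegnerModuleLayer γ (F.zsmul Dt' m hφ) k =
      (twistedHeegnerModuleLayer γ F k).map (zsmulAddGroupHom m) := by
  apply le_antisymm
  · refine (AddSubgroup.closure_le _).mpr ?_
    rintro v ⟨c, i, w', hw', d', hd', rfl⟩
    rw [TwistedHeegnerFamily.generators_zsmul] at hw'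
    obtain ⟨w, hw, rfl⟩ := hw'
    have hfix : ∀ σ ∈ κ.layerSubgroup k, σ • w = w := fun σ hσ ↦
      F.forall_smul_eq_of_mem_generators k w hw σ hσ
    obtain ⟨d, hd⟩ := (W.baseChange K).exists_isKummerFamilyOver p (κ.layerSubgroup k) w hfix
    have hd'K : (W.baseChange K).IsKummerFamilyOver p (κ.layerSubgroup k) (P := m • w)
        (fun σ hσ ↦ by rw [smul_zsmul_geomPoints, hfix σ hσ]) d' := fun n Q hQ ↦ hd' n Q hQ
    have hdd : d' = m • d := hd'K.unique p (hd.zsmul m)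
    refine AddSubgroup.mem_map.mpr ⟨(W.baseChange K).padicPi p (κ.layerSubgroup k) c
      ((W.baseChange K).conjPi p (κ.layerSubgroup k) (γ ^ i) d), ?_, ?_⟩
    · exact AddSubgroup.subset_closure ⟨c, i, w, hw, d, fun n Q hQ ↦ hd n Q hQ, rfl⟩
    · rw [zsmulAddGroupHom_apply, hdd, map_zsmul, map_zsmul]
  · refine AddSubgroup.map_le_iff_le_comap.mpr ((AddSubgroup.closure_le _).mpr ?_)
    rintro v ⟨c, i, w, hw, d, hd, rfl⟩
    have hfix : ∀ σ ∈ κ.layerSubgroup k, σ • w = w := fun σ hσ ↦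
      F.forall_smul_eq_of_mem_generators k w hw σ hσ
    have hdK : (W.baseChange K).IsKummerFamilyOver p (κ.layerSubgroup k) hfix d :=
      fun n Q hQ ↦ hd n Q hQ
    have hw' : m • w ∈ (F.zsmul Dt' m hφ).generators k := by
      rw [TwistedHeegnerFamily.generators_zsmul]; exact Set.mem_image_of_mem _ hw
    refine AddSubgroup.mem_comap.mpr (AddSubgroup.subset_closure ⟨c, i, m • w, hw', m • d,
      fun n Q hQ ↦ (hdK.zsmul m) n Q hQ, ?_⟩)
    rw [zsmulAddGroupHom_apply, map_zsmul, map_zsmul]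

/-- **`ℋ^θ_∞(m • F) = ℋ^θ_∞(F)` for `p ∤ m`** — word for word `heegnerModule_zsmul_of_not_dvd`:
`proj_k ((C m) • s) = m • proj_k s`, the layer identity, injectivity of `m •` on `∏_k H¹(K_k, E[p^k])`,
and `C m ∈ Λˣ`. [cite: PerrinRiou1987BSMF, §1 p. 405 (H_∞ «dépendant du choix de la paramétrisation π»)] [cite: BurungaleCastellaKim2021, Remark after Conj. 1 (the factor c_π, dropped for a p-adic unit)] -/
theorem twistedHeegnerModule_zsmul_of_not_dvd [W.IsElliptic]
    (D : (W.baseChange K).LambdaAdicSelmerData κ γ) (F : TwistedHeegnerFamily N' W W' K κ jbar)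
    (Dt' : ModularParametrizationData W' N') {m : ℤ} (hm : ¬ (p : ℤ) ∣ m)
    (hφ : ∀ τ, Dt'.φ τ = m • F.Dt.φ τ) :
    twistedHeegnerModule D (F.zsmul Dt' m hφ) = twistedHeegnerModule D F := by
  obtain ⟨u, hu, a, -, -⟩ := IwasawaAlgebra.exists_unit_C_intCast (p := p) hm
  have hprojC : ∀ (k : ℕ) (s : D.S), D.proj k ((u : IwasawaAlgebra p) • s) = m • D.proj k s := by
    intro k s
    rw [hu, D.proj_C, padicPi_intCast]
  apply le_antisymm
  · refine Submodule.span_le.mpr ?_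
    intro s' hs'
    have ht : ∀ k, D.proj k ((↑u⁻¹ : IwasawaAlgebra p) • s') ∈ twistedHeegnerModuleLayer γ F k := by
      intro k
      have hk := hs' k
      rw [twistedHeegnerModuleLayer_zsmul, AddSubgroup.mem_map] at hk
      obtain ⟨ℓ, hℓ, hℓeq⟩ := hk
      rw [zsmulAddGroupHom_apply] at hℓeq
      have hinj := (W.baseChange K).zsmul_torsionH1Pi_injective_of_not_dvd p (κ.layerSubgroup k) hm
      have hmt : m • D.proj k ((↑u⁻¹ : IwasawaAlgebra p) • s') = m • ℓ := by
        rw [← hprojC, ← mul_smul, Units.mul_inv, one_smul, hℓeq]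
      rw [hinj hmt]
      exact hℓ
    have ht' : (↑u⁻¹ : IwasawaAlgebra p) • s' ∈ twistedHeegnerModule D F := Submodule.subset_span ht
    have := (twistedHeegnerModule D F).smul_mem (u : IwasawaAlgebra p) ht'
    rwa [← mul_smul, Units.mul_inv, one_smul] at this
  · refine Submodule.span_le.mpr ?_
    intro s hs
    have hus : ∀ k, D.proj k ((u : IwasawaAlgebra p) • s) ∈
        twistedHeegnerModuleLayer γ (F.zsmul Dt' m hφ) k := by
      intro k
      rw [hprojC, twistedHeegnerModuleLayer_zsmul]
      exact AddSubgroup.mem_map.mpr ⟨D.proj k s, hs k, (zsmulAddGroupHom_apply _ _)⟩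
    have hus' : (u : IwasawaAlgebra p) • s ∈ twistedHeegnerModule D (F.zsmul Dt' m hφ) :=
      Submodule.subset_span hus
    have := (twistedHeegnerModule D (F.zsmul Dt' m hφ)).smul_mem (↑u⁻¹ : IwasawaAlgebra p) hus'
    rwa [← mul_smul, Units.inv_mul, one_smul] at this

/-- **`I(ℋ^θ_∞(m • F)) = I(ℋ^θ_∞(F))` for `p ∤ m`.** [cite: PerrinRiou1987BSMF, §1 p. 405 (I(H_∞))] [cite: BurungaleCastellaKim2021, Remark after Conj. 1] -/
theorem twistedHeegnerCharIdeal_zsmul_of_not_dvd [W.IsElliptic]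
    (D : (W.baseChange K).LambdaAdicSelmerData κ γ) (F : TwistedHeegnerFamily N' W W' K κ jbar)
    (Dt' : ModularParametrizationData W' N') {m : ℤ} (hm : ¬ (p : ℤ) ∣ m)
    (hφ : ∀ τ, Dt'.φ τ = m • F.Dt.φ τ) :
    twistedHeegnerCharIdeal D (F.zsmul Dt' m hφ) = twistedHeegnerCharIdeal D F :=
  Module.charIdeal_eq_of_linearEquiv
    (Submodule.quotEquivOfEq _ _ (twistedHeegnerModule_zsmul_of_not_dvd D F Dt' hm hφ))

/-- The same at the constructed rescaling `F.zsmulSelf m`: if the rescaled datum's Manin-constant field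
`m · c` is prime to `p` then so is `m`, and `I(ℋ^θ_∞)` is unchanged — the pin of
`KellerYin2024.thm351_hpmc_equality_minimal_OPEN` read on the twisted objects.
[cite: PerrinRiou1987BSMF, §1 pp. 404–405 (c_π; H_∞ depends on π)] [cite: BurungaleCastellaKim2021, Remark after Conj. 1 (the factor c_π)] -/
theorem twistedHeegnerCharIdeal_zsmulSelf_of_not_dvd [W.IsElliptic]
    (D : (W.baseChange K).LambdaAdicSelmerData κ γ) (F : TwistedHeegnerFamily N' W W' K κ jbar)
    {m : ℤ} (hm0 : m ≠ 0) (hpin : ¬ (p : ℤ) ∣ (F.Dt.zsmul m hm0).c) :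
    twistedHeegnerCharIdeal D (F.zsmulSelf m hm0) = twistedHeegnerCharIdeal D F := by
  have hm : ¬ (p : ℤ) ∣ m := fun h ↦ hpin (by
    change (p : ℤ) ∣ m * F.Dt.c
    exact h.mul_right _)
  exact twistedHeegnerCharIdeal_zsmul_of_not_dvd D F (F.Dt.zsmul m hm0) hm (F.Dt.φ_zsmul hm0)

/-! ### Any `m ≠ 0`: the sandwich and the divisibility -/

/-- **`ℋ^θ_∞(m • F) ⊆ ℋ^θ_∞(F)`** (any `m`): `ℋ̄^θ_k(m • F) = m • ℋ̄^θ_k(F) ⊆ ℋ̄^θ_k(F)`.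
[cite: Howard2004HeegnerKolyvagin, §3.3 (H_k, 𝐇 = lim← H_k)] -/
theorem twistedHeegnerModule_zsmul_le [W.IsElliptic]
    (D : (W.baseChange K).LambdaAdicSelmerData κ γ) (F : TwistedHeegnerFamily N' W W' K κ jbar)
    (Dt' : ModularParametrizationData W' N') (m : ℤ) (hφ : ∀ τ, Dt'.φ τ = m • F.Dt.φ τ) :
    twistedHeegnerModule D (F.zsmul Dt' m hφ) ≤ twistedHeegnerModule D F := by
  refine Submodule.span_mono fun s hs k ↦ ?_
  have hk : D.proj k s ∈ twistedHeegnerModuleLayer γ (F.zsmul Dt' m hφ) k := hs k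
  rw [twistedHeegnerModuleLayer_zsmul, AddSubgroup.mem_map] at hk
  obtain ⟨ℓ, hℓ, hℓeq⟩ := hk
  rw [← hℓeq, zsmulAddGroupHom_apply]
  exact AddSubgroup.zsmul_mem _ hℓ m

/-- **`(C m) • ℋ^θ_∞(F) ⊆ ℋ^θ_∞(m • F)`** (any `m`). [cite: Howard2004HeegnerKolyvagin, §3.3 (H_k, 𝐇 = lim← H_k)] -/
theorem C_smul_mem_twistedHeegnerModule_zsmul [W.IsElliptic]
    (D : (W.baseChange K).LambdaAdicSelmerData κ γ) (F : TwistedHeegnerFamily N' W W' K κ jbar)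
    (Dt' : ModularParametrizationData W' N') (m : ℤ) (hφ : ∀ τ, Dt'.φ τ = m • F.Dt.φ τ)
    {s : D.S} (hs : s ∈ twistedHeegnerModule D F) :
    (PowerSeries.C ((m : ℤ) : ℤ_[p]) : IwasawaAlgebra p) • s ∈ twistedHeegnerModule D (F.zsmul Dt' m hφ) := by
  induction hs using Submodule.span_induction with
  | mem g hg =>
    refine Submodule.subset_span fun k ↦ ?_
    rw [D.proj_C_intCast_smul, twistedHeegnerModuleLayer_zsmul]
    exact AddSubgroup.mem_map.mpr ⟨D.proj k g, hg k, zsmulAddGroupHom_apply _ _⟩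
  | zero => rw [smul_zero]; exact Submodule.zero_mem _
  | add x y _ _ hx hy => rw [smul_add]; exact Submodule.add_mem _ hx hy
  | smul a x _ hx => rw [smul_smul, mul_comm, mul_smul]; exact Submodule.smul_mem _ a hx

/-- **`𝔖/ℋ^θ_∞(m • F)` is torsion when `𝔖/ℋ^θ_∞(F)` is** (`m ≠ 0`). [cite: PerrinRiou1987BSMF, §1 p. 405 (I(H_∞) ≠ 0 iff H_∞ and S_p(D_∞) have the same rank)] -/
theorem isTorsion_quotient_twistedHeegnerModule_zsmul [W.IsElliptic]
    (D : (W.baseChange K).LambdaAdicSelmerData κ γ) (F : TwistedHeegnerFamily N' W W' K κ jbar)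
    (Dt' : ModularParametrizationData W' N') {m : ℤ} (hm0 : m ≠ 0) (hφ : ∀ τ, Dt'.φ τ = m • F.Dt.φ τ)
    (htor : Module.IsTorsion (IwasawaAlgebra p) (D.S ⧸ twistedHeegnerModule D F)) :
    Module.IsTorsion (IwasawaAlgebra p) (D.S ⧸ twistedHeegnerModule D (F.zsmul Dt' m hφ)) := by
  have hC : (PowerSeries.C ((m : ℤ) : ℤ_[p]) : IwasawaAlgebra p) ≠ 0 :=
    (map_ne_zero_iff _ PowerSeries.C_injective).mpr (Int.cast_ne_zero.mpr hm0)
  intro x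
  obtain ⟨s, rfl⟩ := Submodule.mkQ_surjective _ x
  obtain ⟨⟨a, ha⟩, has⟩ := @htor (Submodule.mkQ (twistedHeegnerModule D F) s)
  rw [Submonoid.mk_smul, Submodule.mkQ_apply, ← Submodule.Quotient.mk_smul,
    Submodule.Quotient.mk_eq_zero] at has
  refine ⟨⟨PowerSeries.C ((m : ℤ) : ℤ_[p]) * a, mul_mem (mem_nonZeroDivisors_of_ne_zero hC) ha⟩, ?_⟩
  rw [Submonoid.mk_smul, Submodule.mkQ_apply, ← Submodule.Quotient.mk_smul,
    Submodule.Quotient.mk_eq_zero, mul_smul]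
  exact C_smul_mem_twistedHeegnerModule_zsmul D F Dt' m hφ has

/-- **`I(ℋ^θ_∞(F)) ∣ I(ℋ^θ_∞(m • F))`** (`m ≠ 0`; `𝔖` finitely generated, `𝔖/ℋ^θ_∞(F)` torsion):
multiplicativity of characteristic ideals (`Module.charIdeal_eq_mul_of_exact`) on
`0 → ℋ^θ_∞(F)/ℋ^θ_∞(m • F) → 𝔖/ℋ^θ_∞(m • F) → 𝔖/ℋ^θ_∞(F) → 0`. [cite: PerrinRiou1987BSMF, §1 p. 405 (I(H_∞), H_∞ depends on π)] [cite: NeukirchSchmidtWingberg2008, Ch. V §3 (multiplicativity of characteristic ideals)] -/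
theorem twistedHeegnerCharIdeal_dvd_zsmul [W.IsElliptic]
    (D : (W.baseChange K).LambdaAdicSelmerData κ γ) (F : TwistedHeegnerFamily N' W W' K κ jbar)
    (Dt' : ModularParametrizationData W' N') {m : ℤ} (hm0 : m ≠ 0) (hφ : ∀ τ, Dt'.φ τ = m • F.Dt.φ τ)
    [Module.Finite (IwasawaAlgebra p) D.S]
    (htor : Module.IsTorsion (IwasawaAlgebra p) (D.S ⧸ twistedHeegnerModule D F)) :
    twistedHeegnerCharIdeal D F ∣ twistedHeegnerCharIdeal D (F.zsmul Dt' m hφ) := by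
  have hle : twistedHeegnerModule D (F.zsmul Dt' m hφ) ≤ twistedHeegnerModule D F :=
    twistedHeegnerModule_zsmul_le D F Dt' m hφ
  have hM := isTorsion_quotient_twistedHeegnerModule_zsmul D F Dt' hm0 hφ htor
  have h := Module.charIdeal_eq_mul_of_exact (R := IwasawaAlgebra p) hM
    (LinearMap.ker (Submodule.factor hle)).subtype (Submodule.factor hle)
    (Submodule.injective_subtype _) (Submodule.factor_surjective hle)
    (LinearMap.exact_subtype_ker_map _)
  exact Dvd.intro_left _ h.symm

/-- **The twisted Heegner-module index can only grow under rescaling.** [cite: Howard2004HeegnerKolyvagin, §1 eq. (2) (ord_J 𝐋)] -/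
theorem twistedHeegnerModuleIndex_le_zsmul [W.IsElliptic]
    (D : (W.baseChange K).LambdaAdicSelmerData κ γ) (F : TwistedHeegnerFamily N' W W' K κ jbar)
    (Dt' : ModularParametrizationData W' N') (m : ℤ) (hφ : ∀ τ, Dt'.φ τ = m • F.Dt.φ τ) :
    twistedHeegnerModuleIndex D F ≤ twistedHeegnerModuleIndex D (F.zsmul Dt' m hφ) := by
  rw [twistedHeegnerModuleIndex_def, twistedHeegnerModuleIndex_def]
  exact Module.lengthAt_le_of_surjective (Submodule.factor (twistedHeegnerModule_zsmul_le D F Dt' m hφ))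
    (Submodule.factor_surjective _) _

end TwistedModuleScaling

/-! ## §3 Keller–Yin 2024b's (HPMC) equality currency under rescaling (`K : Type`, as in the owner's file) -/

namespace KellerYin2024

variable {K : Type} [Field K] [NumberField K] {N' : ℕ} [NeZero N'] {W W' : WeierstrassCurve ℚ}
  {p : ℕ} [Fact p.Prime] {κ : ZpExtension K p} {γ : Field.absoluteGaloisGroup K}
  {jbar : AlgebraicClosure K →+* ℂ}

/-- **Inside the `p`-adic-unit Manin class, `HPMCEquality D F X` does not depend on the parametrisation**:
for `p ∤ m`, the typed (HPMC) equality at `F` implies it at `m • F` (`I(ℋ^θ_∞)` is unchanged,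
`twistedHeegnerCharIdeal_zsmul_of_not_dvd`) — the by-name consistency of the Manin pin of
`thm351_hpmc_equality_minimal_OPEN` (cell `bsd-cited`, REGISTER R-15, referee C3 ROUND 500 (b)).
[cite: PerrinRiou1987BSMF, §1 Conj. B p. 405 (the factor c_π · u)] [cite: BurungaleCastellaKim2021, Remark after Conj. 1 (c_π dropped when a p-adic unit)] -/
theorem hpmcEquality_zsmul_of_not_dvd [W.IsElliptic]
    (D : (W.baseChange K).LambdaAdicSelmerData κ γ) (F : TwistedHeegnerFamily N' W W' K κ jbar)
    (X : (W.baseChange K).SelmerDualData κ γ) (Dt' : ModularParametrizationData W' N') {m : ℤ}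
    (hm : ¬ (p : ℤ) ∣ m) (hφ : ∀ τ, Dt'.φ τ = m • F.Dt.φ τ) (h : HPMCEquality D F X) :
    HPMCEquality D (F.zsmul Dt' m hφ) X := by
  obtain ⟨hS, hXf, hX1, hc⟩ := h
  exact ⟨hS, hXf, hX1, by rw [twistedHeegnerCharIdeal_zsmul_of_not_dvd D F Dt' hm hφ]; exact hc⟩

/-- **The Manin-pinned equality is parametrisation-free at the constructed rescaling**: under the pin
`¬ (p : ℤ) ∣ (F.Dt.zsmul m).c`, `HPMCEquality D (F.zsmulSelf m) X ↔ HPMCEquality D F X`.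
[cite: PerrinRiou1987BSMF, §1 Conj. B p. 405 (the factor c_π · u)] [cite: BurungaleCastellaKim2021, Remark after Conj. 1] -/
theorem hpmcEquality_zsmulSelf_iff_of_not_dvd [W.IsElliptic]
    (D : (W.baseChange K).LambdaAdicSelmerData κ γ) (F : TwistedHeegnerFamily N' W W' K κ jbar)
    (X : (W.baseChange K).SelmerDualData κ γ) {m : ℤ} (hm0 : m ≠ 0)
    (hpin : ¬ (p : ℤ) ∣ (F.Dt.zsmul m hm0).c) :
    HPMCEquality D (F.zsmulSelf m hm0) X ↔ HPMCEquality D F X := by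
  unfold HPMCEquality
  rw [twistedHeegnerCharIdeal_zsmulSelf_of_not_dvd D F hm0 hpin]

/-- **The (HPMC) divisibility currency transports along ANY rescaling** once `𝔖/ℋ^θ_∞(F)` is torsion
(e.g. `ℋ^θ_∞(F) ≠ 0` inside a torsion-free rank-one `𝔖`): `HPMCDivisibility D F X` implies
`HPMCDivisibility D (F.zsmul Dt' m) X` (`m ≠ 0`; `twistedHeegnerCharIdeal_dvd_zsmul`) — the twisted
analogue of `dvd_heegnerCharIdeal_sq_zsmul` for Keller–Yin's Thm. 3.3.6 shape.
[cite: Howard2004HeegnerKolyvagin, §1 Thm. B (c) and §1 ("Fixing a modular parametrization")] -/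
theorem hpmcDivisibility_zsmul_of_isTorsion [W.IsElliptic]
    (D : (W.baseChange K).LambdaAdicSelmerData κ γ) (F : TwistedHeegnerFamily N' W W' K κ jbar)
    (X : (W.baseChange K).SelmerDualData κ γ) (Dt' : ModularParametrizationData W' N') {m : ℤ}
    (hm0 : m ≠ 0) (hφ : ∀ τ, Dt'.φ τ = m • F.Dt.φ τ)
    (htor : Module.IsTorsion (IwasawaAlgebra p) (D.S ⧸ twistedHeegnerModule D F))
    (h : HPMCDivisibility D F X) : HPMCDivisibility D (F.zsmul Dt' m hφ) X := by
  obtain ⟨⟨hSf, hS1⟩, hXf, hX1, hc⟩ := h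
  haveI := hSf
  exact ⟨⟨hSf, hS1⟩, hXf, hX1, hc.trans
    (pow_dvd_pow_of_dvd (twistedHeegnerCharIdeal_dvd_zsmul D F Dt' hm0 hφ htor) 2)⟩

end KellerYin2024

end Literature.NumberTheory.EllipticCurves
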